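import Summits.AtomisticToContinuum.HydrodynamicLimit.Theses.OneFlightGossipEngine

/-!
# `ClampedCurrentsDock` (stmt-AtomisticToContinuum-14680) — negative lemma: the energy current is outside the kinetic class of `KineticCurrentsWindowLDUniform`

Load-bearing analysis for the dock `KineticCurrentsWindowLDUniform → EquilibriumClampedCollisionalWindowLD →
CollisionActivityTails → EnergyCurrentTails → DiluteSelfConsistency → HydrodynamicLimit` (route
`OneFlightGossipEngine`; disprover refuter-cdisprove-stmt-AtomisticToContinuum-14680-0,
`Cruxes/ClampedCurrentsDock/Disproof.lean` §3). The kinetic antecedent (stmt-14662) admits functionals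
`F(x,v) = Σ A_jk(x) w_j w_k + (b(x)·w) G(x, ‖w‖²)`, `w = v − u₀(x)`, only under the growth hypothesis
`∃ C, ∀ y, |F y| ≤ C (1 + ‖y.2‖²)`. The fast heat flux of the Euler closure — the order-3 term
`(‖w‖² − 5θ)(w·∇θ)/(2θ²)` of the entropy production, i.e. `A = 0`, `b = ∇θ/(2θ²)`, `G(x,s) = s − 5θ(x)` —
VIOLATES this hypothesis wherever `b ≠ 0` (along the ray `v = u₀(x₀) + t b(x₀)` it grows cubically).
Hence no proof of the dock can feed the energy current to the kinetic antecedent untruncated: the cubic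
mode must be paid by `EnergyCurrentTails` (rate-free uniform integrability) plus whatever the line adds
(stub S6 `CoherentSuprathermalContentVanishes` of line IdeatorTwoSketch) — the locus of
`Literature.Barriers.AtomisticToContinuum.HighMomentumCutoffBarrierNarrow`. Elementary real analysis.
-/

namespace Summit.AtomisticToContinuum.HydrodynamicLimit.Theorems

open scoped BigOperators
open Literature.MathematicalPhysics.KineticTheory

/-- `‖z‖² = Σ z_j²` on `V3`. -/
theorem clampedCurrentsDock_normSq_eq_sum (z : V3) : ‖z‖ ^ 2 = ∑ j : Fin 3, z j ^ 2 := by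
  rw [EuclideanSpace.norm_sq_eq]
  simp [Real.norm_eq_abs, sq_abs]

/-- **The fast heat flux `(b·w)(‖w‖² − 5θ)` admits no quadratic growth bound once `b x₀ ≠ 0`.** -/
theorem clampedCurrentsDock_kineticClass_excludes_heatFlux (θ : T3 → ℝ) (u₀ b : T3 → V3) (x₀ : T3)
    (hb : b x₀ ≠ 0) :
    ¬ ∃ C : ℝ, ∀ y : T3 × V3,
      |(∑ j : Fin 3, b y.1 j * (y.2 - u₀ y.1) j) * (‖y.2 - u₀ y.1‖ ^ 2 - 5 * θ y.1)| ≤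
        C * (1 + ‖y.2‖ ^ 2) := by
  rintro ⟨C, hC⟩
  set β : ℝ := ‖b x₀‖ ^ 2 with hβdef
  have hβ : 0 < β := by
    have : 0 < ‖b x₀‖ := norm_pos_iff.mpr hb
    positivity
  set U : ℝ := ‖u₀ x₀‖ ^ 2 with hUdef
  set θ₀ : ℝ := θ x₀ with hθ₀def
  have hC0 : 0 ≤ C := by
    have h := hC (x₀, u₀ x₀)
    have h1 : (0 : ℝ) ≤ C * (1 + ‖u₀ x₀‖ ^ 2) := le_trans (abs_nonneg _) h
    have h2 : (0 : ℝ) < 1 + ‖u₀ x₀‖ ^ 2 := by positivity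
    nlinarith
  -- evaluate along the ray v = u₀ x₀ + t • b x₀
  have hray : ∀ t : ℝ, 0 ≤ t →
      t ^ 3 * β ^ 2 - 5 * θ₀ * t * β ≤ C * (1 + 2 * U + 2 * t ^ 2 * β) := by
    intro t _ht
    have h := hC (x₀, u₀ x₀ + t • b x₀)
    simp only at h
    have hw : u₀ x₀ + t • b x₀ - u₀ x₀ = t • b x₀ := add_sub_cancel_left _ _
    rw [hw] at h
    have hsum : ∑ j : Fin 3, b x₀ j * (t • b x₀) j = t * β := by
      have : ∀ j : Fin 3, b x₀ j * (t • b x₀) j = t * (b x₀ j ^ 2) := by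
        intro j
        rw [PiLp.smul_apply, smul_eq_mul]
        ring
      simp_rw [this, ← Finset.mul_sum, hβdef, clampedCurrentsDock_normSq_eq_sum]
    have hnorm : ‖t • b x₀‖ ^ 2 = t ^ 2 * β := by
      rw [norm_smul, mul_pow, Real.norm_eq_abs, sq_abs]
    rw [hsum, hnorm] at h
    have hv : ‖u₀ x₀ + t • b x₀‖ ^ 2 ≤ 2 * U + 2 * t ^ 2 * β := by
      have h1 : ‖u₀ x₀ + t • b x₀‖ ≤ ‖u₀ x₀‖ + ‖t • b x₀‖ := norm_add_le _ _
      have h5 : 0 ≤ ‖u₀ x₀ + t • b x₀‖ := norm_nonneg _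
      have h6 : ‖u₀ x₀ + t • b x₀‖ ^ 2 ≤ (‖u₀ x₀‖ + ‖t • b x₀‖) ^ 2 :=
        pow_le_pow_left₀ h5 h1 2
      have h7 : (‖u₀ x₀‖ + ‖t • b x₀‖) ^ 2 ≤ 2 * ‖u₀ x₀‖ ^ 2 + 2 * ‖t • b x₀‖ ^ 2 := by
        nlinarith [sq_nonneg (‖u₀ x₀‖ - ‖t • b x₀‖)]
      rw [hnorm] at h7
      rw [hUdef]
      linarith
    have hle : t * β * (t ^ 2 * β - 5 * θ₀) ≤ C * (1 + ‖u₀ x₀ + t • b x₀‖ ^ 2) :=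
      le_trans (le_abs_self _) h
    have hmono : C * (1 + ‖u₀ x₀ + t • b x₀‖ ^ 2) ≤ C * (1 + 2 * U + 2 * t ^ 2 * β) := by
      have : 1 + ‖u₀ x₀ + t • b x₀‖ ^ 2 ≤ 1 + 2 * U + 2 * t ^ 2 * β := by linarith
      exact mul_le_mul_of_nonneg_left this hC0
    nlinarith
  -- choose t large: t ≥ 1 and t β² ≥ K + 1
  set K : ℝ := 5 * |θ₀| * β + 2 * C * β + C * (1 + 2 * U) with hKdef
  set t : ℝ := max 1 ((K + 1) / β ^ 2) with htdef
  have ht1 : 1 ≤ t := le_max_left _ _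
  have ht0 : 0 < t := by linarith
  have htK : K + 1 ≤ t * β ^ 2 := by
    have : (K + 1) / β ^ 2 ≤ t := le_max_right _ _
    have hβ2 : 0 < β ^ 2 := by positivity
    calc K + 1 = (K + 1) / β ^ 2 * β ^ 2 := by field_simp
      _ ≤ t * β ^ 2 := mul_le_mul_of_nonneg_right this hβ2.le
  have h1 := hray t ht0.le
  have h2 : 5 * θ₀ * t * β ≤ 5 * |θ₀| * β * t ^ 2 := by
    have ha : θ₀ ≤ |θ₀| := le_abs_self _
    have hb' : t ≤ t ^ 2 := by nlinarith
    have e1 : 5 * θ₀ * t * β ≤ 5 * |θ₀| * t * β := by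
      have : 0 ≤ 5 * t * β := by positivity
      nlinarith
    have e2 : 5 * |θ₀| * t * β ≤ 5 * |θ₀| * t ^ 2 * β := by
      have : 0 ≤ 5 * |θ₀| * β := by positivity
      nlinarith
    linarith
  have h3 : C * (1 + 2 * U) ≤ C * (1 + 2 * U) * t ^ 2 := by
    have hc : 0 ≤ C * (1 + 2 * U) := by
      have : 0 ≤ U := by positivity
      positivity
    have : (1 : ℝ) ≤ t ^ 2 := by nlinarith
    nlinarith
  have h4 : t ^ 3 * β ^ 2 ≤ K * t ^ 2 := by
    rw [hKdef]
    nlinarith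
  have h5 : t * β ^ 2 ≤ K := by
    have ht2 : 0 < t ^ 2 := by positivity
    have : t * β ^ 2 * t ^ 2 ≤ K * t ^ 2 := by nlinarith
    exact le_of_mul_le_mul_right this ht2
  linarith

/-- **The growth hypothesis of `KineticCurrentsWindowLDUniform` fails for the energy current**: the
class term of stmt-14662 verbatim with `A = 0` and `G (x, s) = s − 5 θ x`. -/
theorem clampedCurrentsDock_kcwuGrowth_fails_for_heatFlux (θ : T3 → ℝ) (u₀ b : T3 → V3) (x₀ : T3)
    (hb : b x₀ ≠ 0) :
    ¬ ∃ C : ℝ, ∀ y : T3 × V3,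
      |(fun y : T3 × V3 =>
          ((∑ j : Fin 3, ∑ k : Fin 3, (fun (_ : T3) (_ _ : Fin 3) => (0 : ℝ)) y.1 j k *
              ((y.2 - u₀ y.1) j * (y.2 - u₀ y.1) k)) +
            (∑ j : Fin 3, b y.1 j * (y.2 - u₀ y.1) j) *
              (fun p : T3 × ℝ => p.2 - 5 * θ p.1) (y.1, ‖y.2 - u₀ y.1‖ ^ 2))) y| ≤
        C * (1 + ‖y.2‖ ^ 2) := by
  simpa using clampedCurrentsDock_kineticClass_excludes_heatFlux θ u₀ b x₀ hb

end Summit.AtomisticToContinuum.HydrodynamicLimit.Theorems
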